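import Literature.MathematicalPhysics.QuantumFieldTheory.Balaban1983to89.B6BlockHolderCalculus
import Literature.MathematicalPhysics.QuantumFieldTheory.Balaban1983to89.B6BlockDecayGradFactorsV1

/-!
# `Balaban1983to89.B6BlockHolderHjV1` — T. Bałaban, *Propagators and renormalization transformations for lattice gauge theories. II*,
# Commun. Math. Phys. **96** (1984) 223–250 [Balaban1984PropagatorsII], Proposition 2.5 p. 246 / [4] Prop. 1.2 (1.111) p. 35: THE HÖLDER-IN-THE-OUTPUT
# (PAIR) BOUND OF THE FIRST FACTOR `∇_λH_j` of `∇(H_jC̃^{(j)}_ΛH_j*)` and `∇G̃_j = ∇G^{(w′)} − ∇H_jQ_jG^{(w′)}` in (2.129), for `tsV1`, from b05's decaying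
# Hölder bound of the kernel of `∂_νH_k` — file H3a of the (1.111) members of the two-level decay programme

statement-level skeleton of published theorems with citation tags; proofs where landed; nothing here is a claim about the Yang–Mills mass gap

PDF held: `paper:balaban1984-cmp96-propagators-rt-ii` (journal page = PDF page + 222), p. 246 [PDF 24]; `paper:balaban1984-cmp95-propagators-rt-i` ([4],
journal page = PDF page + 16), pp. 28–29, 35 [PDF 12–13, 19].  PRINT.  [4] p. 28 last lines – p. 29 l. 1–2 (verbatim, as quoted by b05's
`…B5Hk163TorusHolderDecay`): *"This implies bounds on (1/|x′−x|^α)|∂_ν(H_kB)_μ(x′) − ∂_ν(H_kB)_μ(x)| (see the proof of Lemma 2.4 in [2].)"*; [B6] p. 246: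
*"H_j = G_jQ_j*(Q_jG_jQ_j*)⁻¹ (2.130) Thus this operator coincides with the operator introduced in Sect. D. … derivatives of H_j up to third order, and
their local Hölder norms as in (2.67), are uniformly bounded and have a uniform exponential decay with a decay rate depending on d only."*

CITATION HEADER (lean-in-tree rule) — WHAT IS REPRODUCED.  Phase-2 file of the `lit-balaban` typed skeleton (HOME `run/shared/lean/pub/lit-balaban/`),
seat **p38 gen 21** (B6 fold owner r03, referee ref-4), FILE H3a of the (1.111) members of seat p22's Prop. 2.5 two-level decay programme (H1
`…B6BlockHolderCalculus`, H2 `…B6BlockHolderLipschitzV1`); SKELETON rows **B6.Prop2.5** / **B6.Eq2.130** (cells only; decls of record untouched).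
§1 the signed displacement between two fine sites read on b05's torus (`exists_displacement`: `EK x′ = EK x + z̄`, `|z_ν| ≤ |x − x′|_∞`;
`rpow_zlen_div_le`: `(‖z‖₂/n)^α ≤ (d+1)(|x − x′|_∞/n)^α`); §2 **`abs_DHj_pair_le`**: for fine bonds `b₁ = ⟨x, μ₀⟩`, `b₂ = ⟨x′, μ₀⟩` with
`|x − x′|_∞ ≤ n` and a unit bond `b`, `|(D_λH_j)(e_b)_{b₁} − (D_λH_j)(e_b)_{b₂}| ≤ CHD(d,α)(d+1)e^{κ_H}·(|x − x′|_∞/n)^α·e^{−κ_H(1−α)/(1+α)·|y(x) − b₋|_T}`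
(`κ_H = κ₁₆₃(d+1)/(d+1)`) — p22's `DHj_single_apply` (the entries of `D_λH_j` ARE b05's kernel `∂_λH_k`) and b05's `norm_dker_sub_le_decay'` BY NAME,
the nearer-endpoint minimum resolved by block adjacency (`supDist_blk_le_one`); **`holderBound_DHj`**: the pair bound
`(CHD(d,α)(d+1)²e^{κ_H}(|x − x′|_∞/n)^α, κ_H(1−α)/(1+α))` of `D_λH_j` (unit bonds → fine bonds) anchored at `y(x)`.  IMPORTS BY NAME, restating
nothing.  THEOREMS ONLY; standard axioms.  HONEST SCOPE / DIVERGENCE: the decay RATE `κ_H(1−α)/(1+α)` DEGRADES AS `α ↑ 1` — inherited from b05's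
interpolation route (its HONEST LIMITS (i)); print claims an `α`-independent rate («δ₂ … depends on d and L only»), which would follow from (2.130) and
[4] (1.111) for `G_j` (route of [BalabanImbrieJaffe1985] (7.2.2), tree `…BIJ85Ineq722DeltaA`) once the kernel identification of `tsV1`'s `H_j` with
`…BIJ85Ineq722Proof.Rep103.H` is in the tree — NOT done here (HOME/GAPS.md).  Constants ours; NOT summit progress.  Unit `lit-balaban-p38` (gen 21), 2026-08-22.
-/

noncomputable section

open scoped InnerProductSpace BigOperators Matrix
open Finset

namespace Literature.MathematicalPhysics.QuantumFieldTheory.Balaban1983to89.B6BlockHolderHjV1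

open LatticeFieldCalculus B5SectBStatements B5Eq117TorusCarriers B6SectAOperatorsV1 B6SectCOperators
  B6SectCTwoScaleV1 B6SectCTwoScaleV1Lattice B5Eq118OneStroke
open BalabanImbrieJaffe1984to88.BIJ85AxialPropagator411 (BondSpace)
open B4Sect5Torus (IsPseudoDist SumBound)
open B4TorusKernel.MultiPeriod (torusSupNorm torusSupNorm_nonneg)
open B3TorusRadialSums (cdist cdist_le_supDist supDist_comm eq_or_eq_neg_of_cdist_eq)
open B5Prop11Plancherel (Tor fine)
open B5Blocks16 (blockOf_bpt)
open B5G183Kernel (exists_eq_bpt)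
open B5Hk163Strip (kappa163 kappa163_pos)
open B5Hk163TorusHolder (zlen zlen_nonneg)
open B5Hk163TorusHolderDecay (CHD CdecD_nonneg CHolderTorus_nonneg thetaH_nonneg norm_dker_sub_le_decay')
open B6LowerBound2153Torus (toT rep toT_rep)
open B6BlockHolderCalculus (holderBound_of_entry)
open B6BlockDecayCalculus (torusDist_isPseudoDist)
open B6BlockDecayHjCovV1 (blockOf_EK_eq_iterBlockOf card_fiber_src_le)
open B6BlockDecayHprimeCovV1 (supDist_cast_eq_torusSupNorm)
open B6BlockDecayGradFactorsV1 (DHj_single_apply)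
open BalabanImbrieJaffe1984to88.BIJ85Ineq722Torus (supDist_blk_le_one)

/-! ## §1  The signed displacement between two fine sites, read on b05's torus `Tor (fine n M)` -/

section Displacement

variable {P : Params} {j : ℕ}

/-- **the signed displacement**: for fine sites `x, x′` there is `z ∈ ℤ^d` with `EK x′ = EK x + z̄` on b05's torus and `|z_ν| ≤ |x − x′|_∞` (each
coordinate difference is `± cdist`). [cite: Balaban1984PropagatorsI, p.29 lines 1–2 (the displacement x′ − x; bookkeeping ours)] -/
theorem exists_displacement (hj' : j ≤ P.m + P.K) (x x' : Site P 0) :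
    ∃ z : Fin P.d → ℤ, EK hj' x' = EK hj' x + toT (fine (P.L ^ j) (Mk P j)) z ∧ ∀ ν, |z ν| ≤ (supDist x x' : ℤ) := by
  have key : ∀ ν, ∃ zν : ℤ, x' ν = x ν + (zν : ZMod (P.sitesPerDir 0)) ∧ |zν| ≤ (supDist x x' : ℤ) := by
    intro ν
    have ht : cdist (x' ν - x ν) ≤ supDist x x' := by rw [supDist_comm]; exact cdist_le_supDist x' x ν
    rcases eq_or_eq_neg_of_cdist_eq (x' ν - x ν) _ rfl with h | h
    · refine ⟨(cdist (x' ν - x ν) : ℤ), ?_, by rw [Nat.abs_cast]; exact_mod_cast ht⟩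
      rw [Int.cast_natCast, ← h]; ring
    · refine ⟨-(cdist (x' ν - x ν) : ℤ), ?_, by rw [abs_neg, Nat.abs_cast]; exact_mod_cast ht⟩
      have e : x' ν = x ν + (x' ν - x ν) := by ring
      rw [Int.cast_neg, Int.cast_natCast, ← h]
      exact e
  choose z hz using key
  refine ⟨z, funext fun ν => ?_, fun ν => (hz ν).2⟩
  rw [Pi.add_apply, EK_apply, EK_apply, (hz ν).1, map_add, map_intCast]
  rfl

/-- `(‖z‖₂/n)^α ≤ (d+1)·(D/n)^α` when `|z_ν| ≤ D`, `0 ≤ α ≤ 1` (`‖z‖₂ ≤ √d·D`, `(√d)^α ≤ √d ≤ d` for `d ≥ 1`; here `d` is `P.d ≥ 1`).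
[cite: Balaban1984PropagatorsI, (1.109) p.35 (|x − x′|; norms comparison ours)] -/
theorem rpow_zlen_div_le {z : Fin P.d → ℤ} {D : ℕ} (hz : ∀ ν, |z ν| ≤ (D : ℤ)) {n : ℝ} (hn : 0 < n) {α : ℝ} (hα0 : 0 ≤ α) (hα1 : α ≤ 1) :
    (zlen z / n) ^ α ≤ (P.d : ℝ) * ((D : ℝ) / n) ^ α := by
  have hd1 : (1 : ℝ) ≤ P.d := by exact_mod_cast P.hd
  have hzl : zlen z ≤ Real.sqrt P.d * D := by
    unfold zlen
    have h1 : ∑ ν : Fin P.d, ((z ν : ℝ)) ^ 2 ≤ (P.d : ℝ) * (D : ℝ) ^ 2 := by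
      calc ∑ ν : Fin P.d, ((z ν : ℝ)) ^ 2 ≤ ∑ _ν : Fin P.d, (D : ℝ) ^ 2 :=
            Finset.sum_le_sum fun ν _ => by
              have h := hz ν
              have h' : |(z ν : ℝ)| ≤ D := by exact_mod_cast h
              exact sq_le_sq' (abs_le.mp h').1 (abs_le.mp h').2
        _ = (P.d : ℝ) * (D : ℝ) ^ 2 := by rw [Finset.sum_const, Finset.card_univ, Fintype.card_fin, nsmul_eq_mul]
    calc Real.sqrt (∑ ν, ((z ν : ℝ)) ^ 2) ≤ Real.sqrt ((P.d : ℝ) * (D : ℝ) ^ 2) := Real.sqrt_le_sqrt h1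
      _ = Real.sqrt P.d * D := by rw [Real.sqrt_mul (Nat.cast_nonneg _), Real.sqrt_sq (Nat.cast_nonneg _)]
  have hs1 : (1 : ℝ) ≤ Real.sqrt P.d := by rw [← Real.sqrt_one]; exact Real.sqrt_le_sqrt hd1
  have hsd : Real.sqrt (P.d : ℝ) ≤ P.d := by
    have h := Real.sqrt_le_sqrt (show (P.d : ℝ) ≤ (P.d : ℝ) ^ 2 by nlinarith)
    rwa [Real.sqrt_sq (Nat.cast_nonneg _)] at h
  calc (zlen z / n) ^ α ≤ (Real.sqrt P.d * D / n) ^ α :=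
        Real.rpow_le_rpow (div_nonneg (zlen_nonneg z) hn.le) (div_le_div_of_nonneg_right hzl hn.le) hα0
    _ = (Real.sqrt P.d) ^ α * ((D : ℝ) / n) ^ α := by
        rw [mul_div_assoc, Real.mul_rpow (Real.sqrt_nonneg _) (by positivity)]
    _ ≤ (P.d : ℝ) * ((D : ℝ) / n) ^ α := by
        refine mul_le_mul_of_nonneg_right ?_ (Real.rpow_nonneg (by positivity) _)
        calc (Real.sqrt P.d) ^ α ≤ (Real.sqrt P.d) ^ (1 : ℝ) := Real.rpow_le_rpow_of_exponent_le hs1 hα1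
          _ = Real.sqrt P.d := Real.rpow_one _
          _ ≤ P.d := hsd

end Displacement

/-! ## §2  The pair bound of `D_λH_j` from b05's decaying Hölder bound of `∂_νH_k` -/

section DHjHolder

variable {d L m K : ℕ} [NeZero L] {hd : 1 ≤ d + 1} {hL : Odd L ∧ 1 < L} {c : ℝ} (hc : c ≠ 0) {j : ℕ}
  (hj : j + 1 ≤ (⟨d + 1, L, m, K, hd, hL⟩ : Params).m + (⟨d + 1, L, m, K, hd, hL⟩ : Params).K)
  (Λ' : Finset (Site (⟨d + 1, L, m, K, hd, hL⟩ : Params) (j + 1))) {w : CIdx j Λ' → ℝ} (hw : ∀ i, 0 < w i)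
  [DecidableEq (PBond (⟨d + 1, L, m, K, hd, hL⟩ : Params) j)]

/-- `0 ≤ CHD(d, α)` for `0 ≤ α < 1`. [cite: Balaban1984PropagatorsI, p.29 lines 1–2 (constant of b05's reading; ours)] -/
theorem CHD_nonneg {α : ℝ} (hα0 : 0 ≤ α) (hα1 : α < 1) : 0 ≤ CHD d α := by
  unfold CHD
  have h1 : 0 ≤ (1 + α) / 2 := by linarith
  have h2 : (1 + α) / 2 < 1 := by linarith
  exact mul_nonneg (Real.rpow_nonneg (CHolderTorus_nonneg (0 : Fin (d + 1)) h1 h2) _)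
    (Real.rpow_nonneg (mul_nonneg zero_le_two CdecD_nonneg) _)

include hj hw in
/-- **THE ENTRIES OF `D_λH_j` ARE HÖLDER IN THE FINE VARIABLE, WITH DECAY**: for fine bonds `b₁ = ⟨x, μ₀⟩`, `b₂ = ⟨x′, μ₀⟩` with `|x − x′|_∞ ≤ n = L^j`,
every unit bond `b` and `0 ≤ α < 1`,
`|(D_λH_j)(e_b)_{b₁} − (D_λH_j)(e_b)_{b₂}| ≤ CHD(d,α)·(d+1)·e^{κ_H}·(|x − x′|_∞/n)^α·e^{−κ_H((1−α)/(1+α))|y(x) − b₋|_T}`, `κ_H = κ₁₆₃(d+1)/(d+1)` — b05's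
`norm_dker_sub_le_decay'` (decay from the NEARER endpoint block) BY NAME; the two endpoint blocks are equal or adjacent, which costs `e^{κ_H}`.
[cite: Balaban1984PropagatorsI, p.29 lines 1–2; Balaban1984PropagatorsII, (2.130) p.246 («their local Hölder norms … uniformly bounded»)] -/
theorem abs_DHj_pair_le {α : ℝ} (hα0 : 0 ≤ α) (hα1 : α < 1) (lam : Fin (d + 1))
    (b₁ b₂ : PBond (⟨d + 1, L, m, K, hd, hL⟩ : Params) 0) (hdir : b₁.dir = b₂.dir) (hle : supDist b₁.src b₂.src ≤ L ^ j)
    (b : PBond (⟨d + 1, L, m, K, hd, hL⟩ : Params) j) :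
    |(((((L : ℝ) ^ j) • (onE (LinearMap.funLeft ℝ ℝ (fun b : PBond (⟨d + 1, L, m, K, hd, hL⟩ : Params) 0 =>
        (⟨b.src.shift lam, b.dir⟩ : PBond (⟨d + 1, L, m, K, hd, hL⟩ : Params) 0))) - LinearMap.id) :
          BondSpace (⟨d + 1, L, m, K, hd, hL⟩ : Params) →ₗ[ℝ] BondSpace (⟨d + 1, L, m, K, hd, hL⟩ : Params))) ∘ₗ (tsV1 hc Λ' w).Hj)
        (EuclideanSpace.single b (1 : ℝ)) b₁ -
      (((((L : ℝ) ^ j) • (onE (LinearMap.funLeft ℝ ℝ (fun b : PBond (⟨d + 1, L, m, K, hd, hL⟩ : Params) 0 =>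
        (⟨b.src.shift lam, b.dir⟩ : PBond (⟨d + 1, L, m, K, hd, hL⟩ : Params) 0))) - LinearMap.id) :
          BondSpace (⟨d + 1, L, m, K, hd, hL⟩ : Params) →ₗ[ℝ] BondSpace (⟨d + 1, L, m, K, hd, hL⟩ : Params))) ∘ₗ (tsV1 hc Λ' w).Hj)
        (EuclideanSpace.single b (1 : ℝ)) b₂| ≤
      CHD d α * ((d + 1 : ℕ) : ℝ) * Real.exp (kappa163 (d + 1) / ((d : ℝ) + 1)) * (((supDist b₁.src b₂.src : ℕ) : ℝ) / (L : ℝ) ^ j) ^ α *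
        Real.exp (-(kappa163 (d + 1) / ((d : ℝ) + 1) * ((1 - α) / (1 + α)) *
          torusSupNorm (Mk (⟨d + 1, L, m, K, hd, hL⟩ : Params) j)
            (rep (Mk (⟨d + 1, L, m, K, hd, hL⟩ : Params) j) (iterBlockOf j b₁.src) - rep (Mk (⟨d + 1, L, m, K, hd, hL⟩ : Params) j) b.src))) := by
  have hj' : j ≤ m + K := Nat.le_of_succ_le hj
  have hLj : (0 : ℝ) < (L : ℝ) ^ j := pow_pos (Nat.cast_pos.2 (Nat.pos_of_ne_zero (NeZero.ne L))) _
  set κH : ℝ := kappa163 (d + 1) / ((d : ℝ) + 1) with hκH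
  have hκH0 : 0 < κH := div_pos (kappa163_pos _) (by positivity)
  set r : ℝ := κH * ((1 - α) / (1 + α)) with hr
  have hr0 : 0 ≤ r := mul_nonneg hκH0.le (div_nonneg (by linarith) (by linarith))
  have hrκ : r ≤ κH := by
    rw [hr]
    have : (1 - α) / (1 + α) ≤ 1 := by rw [div_le_one (by linarith)]; linarith
    exact (mul_le_mul_of_nonneg_left this hκH0.le).trans (le_of_eq (mul_one _))
  rw [DHj_single_apply hc hj Λ' hw, DHj_single_apply hc hj Λ' hw, ← hdir]
  -- block decompositions of the two fine points
  obtain ⟨y₁, a₁, h₁⟩ := exists_eq_bpt (L ^ j) (Mk (⟨d + 1, L, m, K, hd, hL⟩ : Params) j) (EK hj' b₁.src)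
  obtain ⟨y₂, a₂, h₂⟩ := exists_eq_bpt (L ^ j) (Mk (⟨d + 1, L, m, K, hd, hL⟩ : Params) j) (EK hj' b₂.src)
  have hy₁ : iterBlockOf j b₁.src = y₁ := by rw [← blockOf_EK_eq_iterBlockOf hj', h₁, blockOf_bpt]
  have hy₂ : iterBlockOf j b₂.src = y₂ := by rw [← blockOf_EK_eq_iterBlockOf hj', h₂, blockOf_bpt]
  obtain ⟨z, hz, hzD⟩ := exists_displacement (P := (⟨d + 1, L, m, K, hd, hL⟩ : Params)) hj' b₁.src b₂.src
  have hz' : B5Block118.bpt (L ^ j) (Mk (⟨d + 1, L, m, K, hd, hL⟩ : Params) j) (toT (Mk (⟨d + 1, L, m, K, hd, hL⟩ : Params) j)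
        (rep (Mk (⟨d + 1, L, m, K, hd, hL⟩ : Params) j) y₂)) a₂ =
      B5Block118.bpt (L ^ j) (Mk (⟨d + 1, L, m, K, hd, hL⟩ : Params) j) (toT (Mk (⟨d + 1, L, m, K, hd, hL⟩ : Params) j)
        (rep (Mk (⟨d + 1, L, m, K, hd, hL⟩ : Params) j) y₁)) a₁ + toT (fine (L ^ j) (Mk (⟨d + 1, L, m, K, hd, hL⟩ : Params) j)) z := by
    rw [toT_rep, toT_rep, ← h₁, ← h₂]; exact hz
  have hmain := norm_dker_sub_le_decay' (L ^ j) (Mk (⟨d + 1, L, m, K, hd, hL⟩ : Params) j) b₁.dir b.dir lam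
    (rep (Mk (⟨d + 1, L, m, K, hd, hL⟩ : Params) j) y₁) (rep (Mk (⟨d + 1, L, m, K, hd, hL⟩ : Params) j) y₂)
    (rep (Mk (⟨d + 1, L, m, K, hd, hL⟩ : Params) j) b.src) a₁ a₂ z hz' hα0 hα1
  rw [toT_rep, toT_rep, toT_rep, ← h₁, ← h₂] at hmain
  -- the displacement length and the nearer-endpoint minimum
  have hzl : (zlen z / (L ^ j : ℕ)) ^ α ≤ ((d + 1 : ℕ) : ℝ) * (((supDist b₁.src b₂.src : ℕ) : ℝ) / (L : ℝ) ^ j) ^ α := by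
    have h := rpow_zlen_div_le (P := (⟨d + 1, L, m, K, hd, hL⟩ : Params)) hzD (n := ((L ^ j : ℕ) : ℝ)) (by exact_mod_cast pow_pos (Nat.pos_of_ne_zero (NeZero.ne L)) j) hα0 hα1.le
    rw [show ((⟨d + 1, L, m, K, hd, hL⟩ : Params).d : ℝ) = ((d + 1 : ℕ) : ℝ) from rfl, Nat.cast_pow] at h
    rw [Nat.cast_pow]
    exact h
  have hadj : torusSupNorm (Mk (⟨d + 1, L, m, K, hd, hL⟩ : Params) j)
      (rep (Mk (⟨d + 1, L, m, K, hd, hL⟩ : Params) j) y₁ - rep (Mk (⟨d + 1, L, m, K, hd, hL⟩ : Params) j) y₂) ≤ 1 := by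
    rw [← hy₁, ← hy₂, ← supDist_cast_eq_torusSupNorm]
    exact_mod_cast supDist_blk_le_one hj' b₁.src b₂.src hle
  have hρ := torusDist_isPseudoDist (Mk (⟨d + 1, L, m, K, hd, hL⟩ : Params) j)
  have hmin : torusSupNorm (Mk (⟨d + 1, L, m, K, hd, hL⟩ : Params) j)
        (rep (Mk (⟨d + 1, L, m, K, hd, hL⟩ : Params) j) y₁ - rep (Mk (⟨d + 1, L, m, K, hd, hL⟩ : Params) j) b.src) - 1 ≤
      min (torusSupNorm (Mk (⟨d + 1, L, m, K, hd, hL⟩ : Params) j)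
          (rep (Mk (⟨d + 1, L, m, K, hd, hL⟩ : Params) j) y₂ - rep (Mk (⟨d + 1, L, m, K, hd, hL⟩ : Params) j) b.src))
        (torusSupNorm (Mk (⟨d + 1, L, m, K, hd, hL⟩ : Params) j)
          (rep (Mk (⟨d + 1, L, m, K, hd, hL⟩ : Params) j) y₁ - rep (Mk (⟨d + 1, L, m, K, hd, hL⟩ : Params) j) b.src)) := by
    refine le_min ?_ (by linarith)
    have t := hρ.triangle y₁ y₂ b.src
    linarith
  have hexp : Real.exp (-(kappa163 (d + 1) / (d + 1) * ((1 - α) / (1 + α)) *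
        min (torusSupNorm (Mk (⟨d + 1, L, m, K, hd, hL⟩ : Params) j)
            (rep (Mk (⟨d + 1, L, m, K, hd, hL⟩ : Params) j) y₂ - rep (Mk (⟨d + 1, L, m, K, hd, hL⟩ : Params) j) b.src))
          (torusSupNorm (Mk (⟨d + 1, L, m, K, hd, hL⟩ : Params) j)
            (rep (Mk (⟨d + 1, L, m, K, hd, hL⟩ : Params) j) y₁ - rep (Mk (⟨d + 1, L, m, K, hd, hL⟩ : Params) j) b.src)))) ≤
      Real.exp κH * Real.exp (-(r * torusSupNorm (Mk (⟨d + 1, L, m, K, hd, hL⟩ : Params) j)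
        (rep (Mk (⟨d + 1, L, m, K, hd, hL⟩ : Params) j) y₁ - rep (Mk (⟨d + 1, L, m, K, hd, hL⟩ : Params) j) b.src))) := by
    rw [← Real.exp_add, show (kappa163 (d + 1) / (d + 1) * ((1 - α) / (1 + α)) : ℝ) = r by rw [hr, hκH]]
    apply Real.exp_le_exp.2
    nlinarith [mul_le_mul_of_nonneg_left hmin hr0, hrκ]
  have hCHD := CHD_nonneg (d := d) hα0 hα1
  calc _ = |((B5Hk163TorusHolder.dker (L ^ j) (Mk (⟨d + 1, L, m, K, hd, hL⟩ : Params) j) b₁.dir b.dir lam (EK hj' b₁.src) b.src) -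
          (B5Hk163TorusHolder.dker (L ^ j) (Mk (⟨d + 1, L, m, K, hd, hL⟩ : Params) j) b₁.dir b.dir lam (EK hj' b₂.src) b.src)).re| := by
        rw [Complex.sub_re]
    _ ≤ ‖B5Hk163TorusHolder.dker (L ^ j) (Mk (⟨d + 1, L, m, K, hd, hL⟩ : Params) j) b₁.dir b.dir lam (EK hj' b₁.src) b.src -
          B5Hk163TorusHolder.dker (L ^ j) (Mk (⟨d + 1, L, m, K, hd, hL⟩ : Params) j) b₁.dir b.dir lam (EK hj' b₂.src) b.src‖ := Complex.abs_re_le_norm _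
    _ = ‖B5Hk163TorusHolder.dker (L ^ j) (Mk (⟨d + 1, L, m, K, hd, hL⟩ : Params) j) b₁.dir b.dir lam (EK hj' b₂.src) b.src -
          B5Hk163TorusHolder.dker (L ^ j) (Mk (⟨d + 1, L, m, K, hd, hL⟩ : Params) j) b₁.dir b.dir lam (EK hj' b₁.src) b.src‖ := norm_sub_rev _ _
    _ ≤ _ := hmain
    _ ≤ CHD d α * (((d + 1 : ℕ) : ℝ) * (((supDist b₁.src b₂.src : ℕ) : ℝ) / (L : ℝ) ^ j) ^ α) *
          (Real.exp κH * Real.exp (-(r * torusSupNorm (Mk (⟨d + 1, L, m, K, hd, hL⟩ : Params) j)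
            (rep (Mk (⟨d + 1, L, m, K, hd, hL⟩ : Params) j) y₁ - rep (Mk (⟨d + 1, L, m, K, hd, hL⟩ : Params) j) b.src)))) := by
        refine mul_le_mul (mul_le_mul_of_nonneg_left hzl hCHD) hexp (Real.exp_pos _).le (by positivity)
    _ = _ := by rw [hy₁, hr, hκH]; ring

include hj hw in
/-- **THE PAIR (HÖLDER-IN-THE-OUTPUT) BOUND OF `D_λH_j`** (unit bonds → fine bonds; the `d+1` unit bonds over a unit site): at every fine pair
`b₁ = ⟨x, μ₀⟩`, `b₂ = ⟨x′, μ₀⟩` with `|x − x′|_∞ ≤ n`, anchored at `y(x)`, the pair bound `(CHD(d,α)(d+1)e^{κ_H}(|x − x′|_∞/n)^α·(d+1), κ_H(1−α)/(1+α))`.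
[cite: Balaban1984PropagatorsI, p.29 lines 1–2 + (1.111) p.35; Balaban1984PropagatorsII, (2.130) p.246] -/
theorem holderBound_DHj {α : ℝ} (hα0 : 0 ≤ α) (hα1 : α < 1) (lam : Fin (d + 1))
    (b₁ b₂ : PBond (⟨d + 1, L, m, K, hd, hL⟩ : Params) 0) (hdir : b₁.dir = b₂.dir) (hle : supDist b₁.src b₂.src ≤ L ^ j)
    (y : Site (⟨d + 1, L, m, K, hd, hL⟩ : Params) j) :
    ∑ b ∈ univ.filter (fun b : PBond (⟨d + 1, L, m, K, hd, hL⟩ : Params) j => b.src = y),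
        |(((((L : ℝ) ^ j) • (onE (LinearMap.funLeft ℝ ℝ (fun b : PBond (⟨d + 1, L, m, K, hd, hL⟩ : Params) 0 =>
            (⟨b.src.shift lam, b.dir⟩ : PBond (⟨d + 1, L, m, K, hd, hL⟩ : Params) 0))) - LinearMap.id) :
          BondSpace (⟨d + 1, L, m, K, hd, hL⟩ : Params) →ₗ[ℝ] BondSpace (⟨d + 1, L, m, K, hd, hL⟩ : Params))) ∘ₗ (tsV1 hc Λ' w).Hj)
            (EuclideanSpace.single b (1 : ℝ)) b₁ -
          (((((L : ℝ) ^ j) • (onE (LinearMap.funLeft ℝ ℝ (fun b : PBond (⟨d + 1, L, m, K, hd, hL⟩ : Params) 0 =>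
            (⟨b.src.shift lam, b.dir⟩ : PBond (⟨d + 1, L, m, K, hd, hL⟩ : Params) 0))) - LinearMap.id) :
          BondSpace (⟨d + 1, L, m, K, hd, hL⟩ : Params) →ₗ[ℝ] BondSpace (⟨d + 1, L, m, K, hd, hL⟩ : Params))) ∘ₗ (tsV1 hc Λ' w).Hj)
            (EuclideanSpace.single b (1 : ℝ)) b₂| ≤
      CHD d α * ((d + 1 : ℕ) : ℝ) * Real.exp (kappa163 (d + 1) / ((d : ℝ) + 1)) * (((supDist b₁.src b₂.src : ℕ) : ℝ) / (L : ℝ) ^ j) ^ α *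
        ((1 * (d + 1) : ℕ) : ℝ) *
        Real.exp (-(kappa163 (d + 1) / ((d : ℝ) + 1) * ((1 - α) / (1 + α)) *
          torusSupNorm (Mk (⟨d + 1, L, m, K, hd, hL⟩ : Params) j)
            (rep (Mk (⟨d + 1, L, m, K, hd, hL⟩ : Params) j) (iterBlockOf j b₁.src) - rep (Mk (⟨d + 1, L, m, K, hd, hL⟩ : Params) j) y))) := by
  have hLj : (0 : ℝ) < (L : ℝ) ^ j := pow_pos (Nat.cast_pos.2 (Nat.pos_of_ne_zero (NeZero.ne L))) _
  have hCHD := CHD_nonneg (d := d) hα0 hα1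
  exact holderBound_of_entry (ρ := (fun t t' : Site (⟨d + 1, L, m, K, hd, hL⟩ : Params) j => torusSupNorm (Mk (⟨d + 1, L, m, K, hd, hL⟩ : Params) j)
      (rep (Mk (⟨d + 1, L, m, K, hd, hL⟩ : Params) j) t - rep (Mk (⟨d + 1, L, m, K, hd, hL⟩ : Params) j) t')))
    _ (fun b : PBond (⟨d + 1, L, m, K, hd, hL⟩ : Params) j => b.src) b₁ b₂ (iterBlockOf j b₁.src)
    (by have : 0 ≤ (((supDist b₁.src b₂.src : ℕ) : ℝ) / (L : ℝ) ^ j) ^ α := Real.rpow_nonneg (by positivity) _; positivity)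
    (card_fiber_src_le (P := (⟨d + 1, L, m, K, hd, hL⟩ : Params)))
    (fun b => abs_DHj_pair_le hc hj Λ' hw hα0 hα1 lam b₁ b₂ hdir hle b) y

end DHjHolder

end Literature.MathematicalPhysics.QuantumFieldTheory.Balaban1983to89.B6BlockHolderHjV1

end
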